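import Mathlib
import HarnessLib
import HarnessLib.Audit
import Summits.QuantumAdvantage.Statement
import Literature.Computability.QuantumComplexity.PauliExpansion
import Literature.Computability.Complexity.CircuitClasses
import Literature.Computability.QuantumComplexity.BQP
import HarnessLib.Audit.Status.Attr

/-!
Route: PauliFlat

DORMANT since 2026-08-24T00:01:54Z (reconciler: no traction for 6.4 d (last activity item-evidence-added at 2026-08-17T14:50:00Z); parked, not closed — `ledger route dormant route-QuantumAdvantage-PauliFlat --off` to reactivate) — unstaffed, not closed; items shared with open routes are served there. `ledger route dormant <id> --off` reactivates.

Route PauliFlat (realises idea card QuantumAdvantage/QuantumAdvantage/xor-blind-to-multiplication;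
NEGATIVE side, Dequantize-shaped).
THESIS X (= item PPThesis, words): every language decided with error 1/3 by a poly-time uniform
oracle-free Clifford+T family is in BPP.
Lean: `Literature.Computability.Cryptography.BQP ⊆ Literature.Computability.Complexity.BPP` (the
same decl as Dequantize's target; this route is an ALTERNATIVE decomposition of it, through a second
simulator class).
IT SUFFICES: `X → ¬ QuantumAdvantage` — the summit is the existential form `∃ L, L ∈ BQP ∧ L ∉ BPP`
(Statement.lean, D-0015), so X refutes it by pure logic; DECIDING THEOREM (D-0027 §2.1, route-repair
2026-08-15): `closes (h0 : PPThesis) (_ : ModMulPauliRank) … (_ : NegPauliTruncation) (_ : Assembly)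
: ¬ QuantumAdvantage := fun ⟨_, hL, hnL⟩ => hnL (h0 hL)`; item Assembly is its documentary frame
`PPThesis → ¬ QuantumAdvantage` (restated: the former hypothesis
`Literature.Computability.QuantumComplexity.BPP_subset_BQP`, BernsteinVazirani1997 §8, is unused
against the existential form and was an unlisted Literature fact — glue.extra-hypothesis — so it is
removed; provable now in one line).
ROAD TO X (expected FALSE; the route exists for its KILLS): the operator-truncation /
Pauli-propagation hypothesis H_PP — for every uniform Clifford+T family the Heisenberg acceptance
observable U_n†Π₀U_n (and its back-propagation through every cut) is 1/10-approximated by poly(n)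
Pauli strings with poly-time computable coefficients — gives X (indeed BQP ⊆ P) by evaluating the
sparse Pauli sum on the product input |x 0^m⟩; its non-uniform form H_PP^nu → BQP ⊆ P/poly is item
PPTruncationCollapse and its negation ¬H_PP^nu is item NegPauliTruncation (both support, provable
now). This is the class of Rall et al. 2019, sparse Pauli dynamics (arXiv:2306.16372), LOWESA
(arXiv:2306.05400), Angrisani et al. (arXiv:2409.01706: guarantees "only for most instances, but not
for all", p.3) and the Pauli-propagation framework (arXiv:2505.21606, Box 4 p.14: worst- vs
average-case truncation error; p.28: "high magic implies worst-case hardness").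
DELIVERABLES = KILLS of H_PP on the canonical witness, Shor's modular-multiplication block W_{a,N} :
|y⟩ ↦ |a·y mod N⟩ (y < N; identity on N ≤ y < 2^n), as self-standing arithmetic statements with
data:
 rank 2 ModMulPauliRank [crux; PROVABLE NOW, elementary]: every |T|-term Pauli operator M has
‖W_{a,N} − M‖_F² ≥ (N − g₋) − |T|·g₋g₊, g± = gcd(a±1,N): δ-approximation in normalised Frobenius
norm at the Kitaev cut (C-W_a)†(X_c ⊗ I)(C-W_a) = |0⟩⟨1|⊗W_a + h.c. of order finding needs ≥ (1/2 −
δ² − o(1))·2^n/(g₋g₊) Pauli terms — exponential for RSA-type N and generic a. (The planner found the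
elementary proof: XOR-coincidences #{y<N : (ay mod N) ⊕ y = u} ≤ min(g₋2^{|u|}, g₊2^{n−|u|}) ≤
√(g₋g₊2^n), item XorCoincidenceBound, + Parseval; verified exhaustively for n ≤ 5; tight up to
constants since a = 3 gives ≈ 2^{n/2}/4 coincidences.)
 rank 3 DigitWalshFlat [crux]: centred linear-approximation-table flatness of y ↦ a·y mod N,
|F̃_a(s,t)| ≤ N^{1−c} uniformly over all Walsh mask pairs (s,t) ≠ (0,0), for all but N^{1−c} units a
(Gelfond / Mauduit–Rivat digits-along-arithmetic-maps with mask uniformity) — kills Pauli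
propagation of a single Z through one multiplication on average over inputs.
 rank 4 ProductFrameFlat [crux]: for all but N^{1−c} units a, every product operator ⊗Q_i with
‖Q_i‖_F² ≤ 2 has overlap ≤ 2^{(1−c)n} with W_{a,N}Π_{<N} — kills locally re-framed (LOWESA-type)
truncation: exponential ℓ1-coefficient mass for product-operator approximants.
 rank 5 KappaTypical [crux]: the XOR-coincidence count κ(a,N) is ≤ N^ε for all but N^{1−δ} units
(white off-Z Pauli spectrum for typical multipliers; data κ = 4–14 for random a, n ≤ 20; resonances
a ≡ ±p·q⁻¹·2^k, e.g. κ(3,N) ≈ 2^{n/2}/4, found at planning).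

Rationale: WHY THIS LINE. Dequantize shoots at ONE simulator class (stabilizer rank) whose kill
(superpolynomial χ_δ(T^{⊗t})) is stuck at Ω̃(t²). The newest dequantizers that defeat noisy and
random circuits are operator-truncation methods (Pauli propagation, arXiv:1901.09070; sparse Pauli
dynamics arXiv:2306.16372; LOWESA arXiv:2306.05400; average-case guarantees arXiv:2409.01706,
arXiv:2407.12768); their road to ¬S is the sparse-Heisenberg-observable hypothesis H_PP, whose
worst-case failure is asserted only qualitatively in print (arXiv:2505.21606 Box 4 p.14, p.28;
arXiv:2409.01706 p.3). This route files H_PP's collapse theorem (PPTruncationCollapse) and PROVABLE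
exponential kills on the canonical witness — Shor's modular multiplication — importing (i) an
elementary XOR/multiplication incidence count (found at planning: κ ≤ √(gcd(a−1,N)gcd(a+1,N)2^n),
tight for a=3), (ii) digital exponential sums à la Gelfond 1968 / Mauduit–Rivat 2010
(doi:10.4007/annals.2010.171.1591) = linear cryptanalysis of modular multiplication (IDEA's ⊙:
Daemen–Govaerts–Vandewalle CRYPTO'93, Hawkes–O'Connor ASIACRYPT'96), (iii) product-frame
(injective-norm) flatness. "XOR does not see multiplication": Pauli sparsity is provably the wrong
currency for classical reversible arithmetic.
RANKED CRUXES (why each might fail; sources in the items).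
 2 ModMulPauliRank: ‖W−M‖_F² ≥ (N−g₋) − |T|g₋g₊ for every |T|-term Pauli sum M. Elementary
(XorCoincidenceBound + Parseval, tree PauliParseval.sum_norm_pauliCoeff_sq); verified exhaustively n
≤ 5; risk only in typed conventions (unnormalised pauliCoeff, ℕ-subtraction, padding y ≥ N ↦ y); no
slack: a=3 has ≈2^{n/2}/4 coincidences (n=20: 256). Ranked first because it settles the card's
programme and unlocks the kill bookkeeping.
 3 DigitWalshFlat: ∃c>0: #{a : max_{(s,t)≠0}|F̃_a(s,t)| > N^{1−c}} ≤ N^{1−c}. Might fail: max over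
all 4^n mask pairs may decay slower than any power (planner data, exhaustive pairs: random a N^0.92,
N^0.91, N^0.90 at n=8,10,11; single-bit masks N^0.86–0.90; card single-bit data to n=16:
N^0.81–0.89), or the resonant set {a ≡ ±p q⁻¹2^k mod d|N} is denser than N^{1−c} (a=2⁻¹ gives
N^1.00; IDEA weak-key classes).
 4 ProductFrameFlat: ∃c>0: for all but N^{1−c} units every Pauli-normalised product operator has
overlap ≤ 2^{(1−c)n} with W_aΠ_{<N}. Might fail: product operators are much richer than Pauli
strings — support patterns give 2^{n/2} already for a=2, phase-dressed all-ones factors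
e^{2πi2^i(b−ab′)/N}/√2 align the modular phase exactly (overlap N2^{−n/2}); the only visible proof
route (expand Q_i in characters → LAT) would need DigitWalshFlat at scale 2^{n/2−cn}, false even for
random permutations.
 5 KappaTypical: ∀ε∃δ: #{a : κ(a,N) > N^ε} ≤ N^{1−δ}. Might fail: resonance zoo richer than small
rationals (planning found a=3, 3/5, 5 at the 2^{n/2} scale; refuter found a ≡ ±1 mod d|N at scale
d); cheapest refutation = kit compute κ census to n≈28.
SUPPORT: XorCoincidenceBound (provable now, 10-line proof in NOTES); PPTruncationCollapse (H_PP^nu →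
BQP ⊆ P/poly: advice = the term list, ⟨x0|S|x0⟩ ∈ {0,±1}; calibrates what the kills kill);
NegPauliTruncation (¬H_PP^nu, provable now from ModMulPauliRank by the KitaevCutKill bookkeeping —
or already from the controlled wire-rotation W_{2,2^n−1}, a Fredkin ladder: H_PP as typed is weak,
the refuter's 'strawman' point conceded; the route's content is the arithmetic).
KILL CRITERIA. ModMulPauliRank refuted as typed → restate (conventions), the mathematics is checked;
DigitWalshFlat refuted (a positive-density set of a with |F̃| ≥ N^{1−o(1)}) → the diagonal-sector
kill dies, route keeps rank 2/4; ProductFrameFlat refuted by an explicit frame with overlap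
2^{n−o(n)} for many a → frame-robustness claim withdrawn and the kill is declared
representation-specific (card's own caveat); all three arithmetic cruxes refuted → close refuted.
H_PP PROVED for uniform families (nobody expects it) → X and ¬S.
NOT DECOMPOSED YET: the UNIFORM H_PP → BQP ⊆ BPP typing (needs a Pauli-term-list encoding, cf.
Dequantize 0244); flatness of the QFT∘arithmetic composite (the representation-switching repair);
the kit census (κ to n≈28, LAT maxima to n≈20, resonance catalogue) — refuter work.
NOVELTY (audit grade new-combination; searches: the card's + refuter audit's arXiv/crossref sweeps,
lit read arXiv:2505.21606 pp.14,28 and arXiv:2409.01706 p.3 this session; lit search/searchd and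
arxiv/openalex/s2 APIs were DOWN all session, rc 75/429, logged): nearest prior = arXiv:2505.21606
Box 4/p.28 and arXiv:2409.01706 §7 (qualitative worst-case caveats, no structured family with a
proof) × DGV93/Hawkes–O'Connor 96 (measured biases of multiplication mod 2^16+1) ×
Gelfond/Mauduit–Rivat (one digital function, no mask uniformity). Delta: κ(a,N) as the exact
Pauli-flatness parameter with the elementary tight bound √(g₋g₊2^n) (new at planning), the
exponential Frobenius no-go at the Kitaev cut, and the two uniform flatness conjectures with data.
BARRIERS (technique_class: simulation, lower-bound, exponential-sums): Relativization /
Algebrization — evaded in kind exactly as Dequantize (statements about explicit arithmetic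
permutations and their Pauli expansions; an oracle gate has no expansion to bound; H_PP says nothing
about BQP^O); NaturalProofs — n/a (flatness of ONE explicit operator, not a constructive dense
property used against P/poly; y ↦ ay mod N is in P); NoiseThresholdUpperBounds / UncorrectedNoise —
adjacent only (the same simulators succeed under constant uncorrected noise; the kill is for the
noiseless witness, consistent); TensorNetworkContraction — orthogonal resource (treewidth), not
engaged; SeparationPrerequisites, PPolyOracles, RandomOracleMethod, TotalFunctionSpeedupLimit,
SupremacyTheoremsNonRelativizing, LinearXEBSpoofing — n/a (negative-side kill, no separation
claimed). Negatives index: empty (2026-08-15).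

Novelty: Grade carried from the card's audit: new-combination
(refuter-novelty-audit-QuantumAdvantage-QuantumAdvantage-6-0, 2026-08-15). Searched: the ideator's
lit read arXiv:2409.01706 --meta, arXiv:2306.16372 --meta; the auditor's arXiv sweep ('Pauli
propagation' 25 hits; 'Walsh modular multiplication' 0), crossref (IDEA/MMB linear cryptanalysis,
Gelfond, Mauduit-Rivat, multiplicative differentials) and lit read of arXiv:2409.01706 s7,
arXiv:2505.21606 Box 4 + p.28, arXiv:2510.22311, arXiv:2410.13856; THIS SESSION: lit read
arXiv:2505.21606 (p.14 Theory Box 4 'worst-case and average-case errors can be within a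
multiplicative factor which is exponential in system size'; p.28 'high magic implies worst-case
hardness and is a necessary but not sufficient condition for average-case hardness') and
arXiv:2409.01706 p.3 ('our provable guarantees hold only for most instances, but not for all
instances'); lit frontier QuantumAdvantage --since 2022 (no operator-truncation lower-bound paper
among the 30 newest descendants); lit galaxy search 'Pauli propagation' --star all (10 rows, none a
lower bound). lit search / searchd (local+hybrid) and the arxiv/openalex/s2 remote APIs were
unavailable all session (rc 75 / HTTP 429) -- logged in NOTES.md; no claim below rests on an
unsearched corpus beyond the audit's.
NEAREST PRIOR ART: (i) arXiv:2505.21606 (Rudolph-Jones-Teng-Angrisani-Holmes 2025) Box 4 / p.28 and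
arXiv:2409.01706 (Angrisani et al. 2024) p.3/s7, arXiv:2510.22311 (Shao-Cheng-Liu 2025,  [refs: 10.4007/annals.2010.171.1591, 2409.01706, 2306.16372, 2505.21606, 2510.22311, 2410.13856, doi:10.4007/annals.2010.171.1591]

Barriers (technique_class: simulation, lower-bound, exponential-sums): Literature.Barriers.QuantumAdvantage.Relativization: evaded in kind (as Dequantize) -- every item is
a statement about an explicit arithmetic permutation W_{a,N} and its Pauli / Walsh / product-frame
expansions, or about sparse Pauli sums evaluated on product inputs; an oracle gate has no Pauli
expansion to bound and H_PP says nothing about BQP^O, so neither the collapse theorem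
PPTruncationCollapse nor the kills relativize (same reason Gottesman-Knill coexists with BQP^O not
subset BPP^O; tree facts exists_oracle_BQPRel_not_subset_BPPRel, Relativization.iff_barrier).
Literature.Barriers.QuantumAdvantage.Algebrization: same verdict
(Algebrization.not_isAlgebrizingInclusion_bqp_bpp constrains proofs of BQP ⊆ BPP of the shape C^A ⊆
D^Ã; a gate-by-gate operator-truncation simulation is not an oracle-inclusion argument and not
arithmetization).
Literature.Barriers.QuantumAdvantage.NaturalProofs: n/a -- Pauli/Walsh flatness of ONE explicit
operator family is not a dense constructive property used against P/poly (the map y |-> a y mod N is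
itself in P); no circuit lower bound is claimed.
Literature.Barriers.QuantumAdvantage.NoiseThresholdUpperBounds (and the companion UncorrectedNoise
file): adjacent only -- the same operator-truncation simulators provably succeed under constant
uncorrected noise (bremnerMontanaroShepherd2017_thm4 regime; Schuster-Yin-Gao-Yao arXiv:2407.12768);
the kills here are for the NOISELESS witness and are consistent with both entries (they explain why
noise

Novelty grade: new-combination — ROUTE REVIEW (refuter, 2026-08-15). Grade carried (card audit new-combination); lit/searchd down all session (rc 75), galaxy 0 hits for 'Walsh spectrum modular multiplication' — no independent prior-art sweep possible, so this records the structural review. ITEMS: all 9 decls elaborate rc0 and are s (refuter refuter-rreview-route-ABC-TwistAmplifica-3a4d97d5-0, 2026-08-15T14:15:32Z; prior: arXiv:2505.21606 Box 4 p.14/p.28, arXiv:2409.01706 §7, Daemen-Govaerts-Vandewalle CRYPTO93 (IDEA weak keys), doi:10.4007/annals.2010.171.1591 (Mauduit-Rivat), arXiv:1901.09070 (Rall et al.))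

History (route lifecycle, newest last):
- 2026-08-15T16:19:54Z · rev 2: restated Assembly (stmt-QuantumAdvantage-0243) — route-repair (glue): deciding theorem `closes (h0 : PPThesis) (_ : ModMulPauliRank) (_ : DigitWalshFlat) (_ : ProductFrameFlat) (_ : KappaTypical) (_ : XorCoinc (planner-rbadge-QuantumAdvantage-PauliFlat-4271e1e9-g2-0)
- 2026-08-16T04:15:10Z · AUTO-CRUX (backfill): PPThesis — hypotheses of the deciding theorem that nothing in the route derives are cruxes (operator:999:1085951)
- 2026-08-24T00:01:54Z · DORMANT — reconciler: no traction for 6.4 d (last activity item-evidence-added at 2026-08-17T14:50:00Z); parked, not closed — `ledger route dormant route-QuantumAdvantage (operator:999:419740)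

sub-problem: QuantumAdvantage · status: dormant · opened planner-plancard-QuantumAdvantage-QuantumAdva-55ba3220-0 2026-08-15T11:00:11Z · rev 2 · ledger route-QuantumAdvantage-PauliFlat
GENERATED by the gate from the ledger (D-0016/17). Provers cite these decls: `theorem foo : Summit.QuantumAdvantage.QuantumAdvantage.Theses.PauliFlat.<Decl> := …` in Summits/QuantumAdvantage/QuantumAdvantage/Theorems/<Name>.lean.
-/

namespace Summit.QuantumAdvantage.QuantumAdvantage.Theses.PauliFlat

open scoped BigOperators Topology Manifold Classical MeasureTheory ProbabilityTheory Matrix InnerProductSpace ComplexConjugate ContinuousMap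
open Filter Set Function TopologicalSpace MeasureTheory

attribute [summit_statement] _root_.QuantumAdvantage

open Literature.QuantumAdvantage

/-- item stmt-QuantumAdvantage-0242 · crux (kind.auto-crux: conjecture-grade) · rank 0 · open · by planner
why it might fail: X puts FACT in BPP (Shor) and runs against the oracle evidence BQP^O ⊄ BPP^O; its road H_PP is refuted outright on an explicit uniform family (NegPauliTruncation, provable now via ModMulPauliRank).
sources: arXiv:2505.21606 Box 4 p.14, p.28, arXiv:2409.01706 p.3, BernsteinVazirani1997 §8, card QuantumAdvantage/QuantumAdvantage/xor-blind-to-multiplication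
Thesis X of route Dequantize, targeting ¬QuantumAdvantage (quantum-advantage.S02, BQP = BPP): every
uniform Clifford+T family with error 1/3 is simulable in BPP. [BernsteinVazirani1997 §8;
BravyiGosset2016] -/
@[route_item "route-QuantumAdvantage-PauliFlat", crux]
def PPThesis : Prop :=
  Literature.Computability.Cryptography.BQP ⊆ Literature.Computability.Complexity.BPP

/-- item stmt-QuantumAdvantage-1987 · crux · rank 2 · open · by planner
why it might fail: Only as typed: conventions (unnormalised pauliCoeff = Tr(S·M), ℕ-subtraction in a−1, padding y ≥ N ↦ y, Matrix.of orientation x=π(y)); the mathematics is elementary and checked numerically, but the √N coefficient scale is tight (a=3), so constants cannot absorb a slip.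
sources: KempeEtAl2010 §2 (tree PauliExpansion / PauliParseval.sum_norm_pauliCoeff_sq), arXiv:2505.21606 Box 4 p.14; p.28, arXiv:2409.01706 p.3, Kitaev quant-ph/9511026, arXiv:1901.09070 (Rall et al., Pauli propagation), card data + planner NOTES.md (kappa_growth.py, verify_rank.py)
[crux; PROVABLE NOW, elementary — the KILL of Pauli-basis operator truncation on Shor's arithmetic
block] W_{a,N} := the permutation unitary |y⟩ ↦ |a·y mod N⟩ for y < N, identity on N ≤ y < 2^n (y =
Nat.ofBits of the register), as a 0/1 matrix on Fin n → Bool. CLAIM: for odd N < 2^n, gcd(a,N) = 1,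
every operator M = Σ_{S∈T} m_S·pauliString S supported on |T| Pauli strings satisfies ‖W_{a,N} −
M‖_F² ≥ (N − g₋) − |T|·g₋·g₊ with g± = gcd(a±1, N). Hence a δ-approximation in normalised Frobenius
norm (‖·‖_F²/2^n ≤ δ²) needs |T| ≥ ((N − g₋)/2^n − δ²)·2^n/(g₋g₊) > (1/2 − δ² − o(1))·2^n/(g₋g₊)
Pauli terms: EXPONENTIAL for RSA-type N and generic a (g₋ = g₊ = 1), at the Kitaev cut (C-W_a)†(X_c
⊗ I)(C-W_a) = |0⟩⟨1|⊗W_a + |1⟩⟨0|⊗W_a† of order finding (whose Pauli spectrum embeds that of W_a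
isometrically: O = ½I − ¼Z_c⊗(W+W†) + (i/4)Y_c⊗(W−W†), |Tr((Z_c⊗S)O)|² + |Tr((Y_c⊗S)O)|² = |Tr(S
W)|²). PROOF (planner; verified exhaustively for n = 3,4,5 over all odd N ≤ 2^n and all a,
compute/verify_rank.py in the planner folder): Parseval Σ_S |Tr(S·W)|² = 2^n‖W‖_F² (tree
PauliParseval.sum_norm_pauliCoeff_sq); the Z-sector {I,Z}^n carries mass 2^n·#Fix with #Fix = (2^n −
N) + gcd(a−1,N); every string wi -/
@[route_item "route-QuantumAdvantage-PauliFlat", crux]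
def ModMulPauliRank : Prop :=
  ∀ n N a : ℕ, N < 2 ^ n → Odd N → Nat.Coprime a N → ∀ (T : Finset (Fin n → Literature.Computability.QuantumComplexity.Pauli)) (m : (Fin n → Literature.Computability.QuantumComplexity.Pauli) → ℂ), ((N : ℝ) - Nat.gcd (a - 1) N) - T.card * (Nat.gcd (a - 1) N * Nat.gcd (a + 1) N) ≤ ∑ x : Fin n → Bool, ∑ y : Fin n → Bool, ‖((Matrix.of fun x y : Fin n → Bool => if Nat.ofBits x = (if Nat.ofBits y < N then a * Nat.ofBits y % N else Nat.ofBits y) then (1 : ℂ) else 0) - ∑ S ∈ T, m S • Literature.Computability.QuantumComplexity.pauliString S) x y‖ ^ 2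

/-- item stmt-QuantumAdvantage-1988 · crux · rank 3 · open · by planner
why it might fail: The max over all 4^n mask pairs may decay slower than any power of N (fitted exponent only 0.92→0.90 from n=8 to 11; union over pairs eats the per-pair Riesz saving ≈0.15/bit), or the resonant set {a ≡ ±p·q⁻¹·2^k mod d, d|N} (IDEA weak-key classes; a=2⁻¹ gives N^1.00) is denser than N^{1−c}.
sources: doi:10.4007/annals.2010.171.1591 (Mauduit–Rivat, Ann. Math. 171, 2010), Gelfond, Acta Arith. 13 (1968) 259–265, Drmota–Mauduit–Rivat, J. London Math. Soc. 2011, Daemen–Govaerts–Vandewalle, Weak keys for IDEA, CRYPTO'93, Hawkes–O'Connor, On applying linear cryptanalysis to IDEA, ASIACRYPT'96, Shparlinski 2003, Cryptographic Applications of Analytic Number Theory (bits of ax mod p)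
[crux] Centred linear-approximation-table (Walsh–Walsh) flatness of modular multiplication, UNIFORM
over all mask pairs, for all but N^{1−c} multipliers: ∃ c > 0 ∃ n₀ ∀ n ≥ n₀ ∀ odd N ∈ (2^{n−1},
2^n): #{a ∈ [0,N) unit : ∃ (s,t) ≠ (0,0), s,t < 2^n, |F̃_a(s,t)| > N^{1−c}} ≤ N^{1−c}, where
F̃_a(s,t) = Σ_{y<N} χ_s(a·y mod N)·χ_t(y) − N^{−1}(Σ_{z<N} χ_s(z))(Σ_{y<N} χ_t(y)) and χ_s(z) =
(−1)^{|s ∧ z|} (the centring removes the trivial interval bias of the top bits of [0,N), e.g. s = t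
= 2^{n−1} when N ≈ 2^{n−1}; pairs with s = 0 or t = 0 give F̃ = 0 automatically since y ↦ ay is a
bijection of [0,N)). CONSEQUENCE (kill #2, diagonal sector, average over inputs): for such a and
every j the Heisenberg observable W_a†Z_jW_a = (−1)^{bit_j(a·y mod N)} (y < N) has all centred Walsh
coefficients ≤ N^{−c}, so every poly(n)-sparse Pauli/diagonal approximant has the WRONG SIGN on Ω(N)
inputs — Pauli propagation of a single Z through one modular multiplication fails on average over
inputs, for most multipliers. PROOF ARCHITECTURE: additive Fourier expansion of χ_s·1_{[0,N)} (1/h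
decay for interval-like masks; Riesz products Π_k(1 ± e(2^kθ)) ≤ 2^n Π_k max(|cos|,|sin|)(π2^kθ), E
log₂ ≈ −0.15/bit, for -/
@[route_item "route-QuantumAdvantage-PauliFlat", crux]
def DigitWalshFlat : Prop :=
  ∃ c : ℝ, 0 < c ∧ ∃ n₀ : ℕ, ∀ n ≥ n₀, ∀ N : ℕ, 2 ^ (n - 1) < N → N < 2 ^ n → Odd N → (((Finset.range N).filter fun a => Nat.Coprime a N ∧ ∃ s < 2 ^ n, ∃ t < 2 ^ n, (s ≠ 0 ∨ t ≠ 0) ∧ (N : ℝ) ^ (1 - c) < |(∑ y ∈ Finset.range N, (∏ i ∈ Finset.range n, (if s.testBit i ∧ (a * y % N).testBit i then (-1 : ℝ) else 1)) * (∏ i ∈ Finset.range n, (if t.testBit i ∧ y.testBit i then (-1 : ℝ) else 1))) - (1 / (N : ℝ)) * (∑ z ∈ Finset.range N, ∏ i ∈ Finset.range n, (if s.testBit i ∧ z.testBit i then (-1 : ℝ) else 1)) * (∑ y ∈ Finset.range N, ∏ i ∈ Finset.range n, (if t.testBit i ∧ y.testBit i then (-1 : ℝ) else 1))|).card : ℝ)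 ≤ (N : ℝ) ^ (1 - c)

/-- item stmt-QuantumAdvantage-1989 · crux · rank 4 · open · by planner
why it might fail: Product operators are far richer than Pauli strings: patterns already reach 2^{n/2} (a=2), phase-dressed factors align the modular phase exactly; an arithmetic-progression-adapted frame might reach 2^{n−o(n)} for many a; the visible proof route (character expansion → LAT) provably cannot work.
sources: arXiv:2306.05400 (LOWESA, Fontana–Rudolph et al.), arXiv:2308.09109 (Rudolph et al., LOWESA for quantum simulation), arXiv:2306.16372 (Begušić–Chan, sparse Pauli dynamics), arXiv:2505.21606 §II (truncation rules, frames), planner NOTES.md (pattern and phase-alignment examples)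
[crux] Frame-robust flatness — kills locally re-framed (LOWESA-type / rotated-basis) operator
truncation: ∃ c > 0 ∃ n₀ ∀ n ≥ n₀ ∀ odd N ∈ (2^{n−1}, 2^n): for all but N^{1−c} units a ∈ [0,N),
EVERY product operator Q = ⊗_i Q_i (Q_i ∈ M_2(ℂ), Pauli normalisation ‖Q_i‖_F² ≤ 2) has |Σ_{y<N} Π_i
Q_i(bit_i(a·y mod N), y_i)| = |⟨Q̄, W_{a,N}Π_{<N}⟩| ≤ 2^{(1−c)n} (trivial bound 2^{n/2}√N ≈ 2^n/√2).
CONSEQUENCE: if M = Σ_k c_k P_k is any combination of Pauli-normalised product operators with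
‖W_aΠ_{<N} − M‖_F ≤ δ√N then Σ_k|c_k| ≥ (1 − δ)·N/2^{(1−c)n} ≥ (1−δ)2^{cn−1}: exponential
ℓ1-coefficient mass for every product-operator approximant, in every local frame simultaneously (the
representation-independence the card asked for at the level of local frames). KNOWN EXTREMISERS
(planner): support patterns (each Q_i a 0/1 matrix on a 2-subset of {0,1}²) recover XOR-coincidences
(≤ √(2N)), 'input bit fixed'/'output bit fixed' alternations give 2^{n/2} for a = 2; phase-dressed
all-ones factors Q_i(b,b′) = e^{2πi2^i(b − a b′)/N}/√2 align the modular phase EXACTLY (overlap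
N·2^{−n/2} ≈ 2^{n/2}; with sup-norm normalisation this example gives N, which is why the Frobenius
normalisation is essential). Ex -/
@[route_item "route-QuantumAdvantage-PauliFlat", crux]
def ProductFrameFlat : Prop :=
  ∃ c : ℝ, 0 < c ∧ ∃ n₀ : ℕ, ∀ n ≥ n₀, ∀ N : ℕ, 2 ^ (n - 1) < N → N < 2 ^ n → Odd N → (((Finset.range N).filter fun a => Nat.Coprime a N ∧ ∃ Q : Fin n → Matrix Bool Bool ℂ, (∀ i, ∑ b : Bool, ∑ b' : Bool, ‖Q i b b'‖ ^ 2 ≤ 2) ∧ (2 : ℝ) ^ ((1 - c) * n) < ‖∑ y : Fin n → Bool, (if Nat.ofBits y < N then ∏ i : Fin n, Q i ((a * Nat.ofBits y % N).testBit i) (y i) else 0)‖).card : ℝ) ≤ (N : ℝ) ^ (1 - c)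

/-- item stmt-QuantumAdvantage-1990 · crux · rank 5 · open · by planner
why it might fail: The resonance zoo may be richer than small rationals ±p/q·2^k and ±1 mod d|N (e.g. a positive-proportion set of a with special continued-fraction structure of a/N could have κ > N^ε), which no N^{1−δ} exceptional set absorbs; refutable by a κ census (kit, n ≤ 28).
sources: card xor-blind-to-multiplication (Conjecture A + data), refuter-novelty-audit-QuantumAdvantage-QuantumAdvantage-6-0 (composite-N resonances), Klimov–Shamir, A new class of invertible mappings (T-functions), CHES 2002 (mixed mod-2^n/XOR maps), Bourgain, GAFA 15 (2005) (Mordell-type sums, DH bit distribution), planner NOTES.md (kappa_growth.py, kappa_resonance.py)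
[crux] The card's Conjecture A in its correct, typical-multiplier form (white off-Z Pauli spectrum):
∀ ε > 0 ∃ δ > 0 ∃ n₀ ∀ n ≥ n₀ ∀ odd N ∈ (2^{n−1}, 2^n): #{a ∈ [0,N) unit : κ(a,N) > N^ε} ≤ N^{1−δ},
κ(a,N) := max_{u ≠ 0} #{y < N : (a·y mod N) ⊕ y = u}. MEANING: for typical a every off-Z Pauli
coefficient of W_{a,N} is ≤ N^ε, so δ-approximation needs ≥ (1/2 − δ²)·4^n/N^{2ε} terms —
essentially ALL of them ('XOR does not see multiplication'). DATA: random a: κ = 4, 6, 8, 13, 11, 10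
(n = 10..20; ≈ the maximum load of N balls in 2^n bins); RESONANCES found at planning (prime N,
compute/kappa_resonance.py, kappa_growth.py): a = 3: κ = 12, 20, 32, 96, 128, 256 for n = 10, 12,
..., 20 (≈ 2^{n/2}/4 — so the elementary bound √(2N) of XorCoincidenceBound is tight up to a
constant and the card's uniform form 'κ ≤ N^{o(1)} off a = ±1' is FALSE); a = 3·5^{−1}: the same
values; a = 5: ≈ 2^{n/2}/30; a = ±p·q^{−1}·2^k with p,q ≤ 7: κ up to 100 at n = 16; refuter audit: a
≡ ±1 mod d | N gives κ ≍ d (N = 3q, n = 16: 1366 and 86). So the exceptional set contains {a ≡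
±p·q^{−1}·2^k (mod d), d | N, p·q small} and the statement only asks it to have size ≤ N^{1−δ(ε)}.
ATTACK: k-th moment over a of the -/
@[route_item "route-QuantumAdvantage-PauliFlat", crux]
def KappaTypical : Prop :=
  ∀ ε : ℝ, 0 < ε → ∃ δ : ℝ, 0 < δ ∧ ∃ n₀ : ℕ, ∀ n ≥ n₀, ∀ N : ℕ, 2 ^ (n - 1) < N → N < 2 ^ n → Odd N → (((Finset.range N).filter fun a => Nat.Coprime a N ∧ ∃ u : ℕ, 0 < u ∧ (N : ℝ) ^ ε < (((Finset.range N).filter fun y => (a * y % N) ^^^ y = u).card : ℝ)).card : ℝ) ≤ (N : ℝ) ^ (1 - δ)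

/-- item stmt-QuantumAdvantage-1991 · support · rank 9 · open · by planner
sources: elementary; planner NOTES.md §KEY FINDINGS 1–2
[support; PROVABLE NOW — the arithmetic heart of ModMulPauliRank] For N ≤ 2^n, 0 < u < 2^n and any
a: #{y < N : (a·y mod N) ⊕ y = u} ≤ min(gcd(a−1,N)·2^{|u|}, gcd(a+1,N)·2^{n−|u|}) (hence ≤
√(gcd(a−1,N)·gcd(a+1,N)·2^n)), |u| = popcount = #{i < n : u.testBit i}. PROOF: y ⊕ u = y + u − 2(y ∧
u), so a coincidence forces (a−1)·y ≡ u − 2w (mod N) with w = y ∧ u ⊆ u: at most gcd(a−1,N)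
solutions y ∈ [0,N) for each of the 2^{|u|} submasks w; complementing inside n bits, y ⊕ u = ȳ ⊕ ū
with ȳ = 2^n − 1 − y, so (a+1)·y ≡ 2^n − 1 + ū − 2w′ (mod N) with w′ = ȳ ∧ ū ⊆ ū: at most
gcd(a+1,N)·2^{n−|u|}. (a = 0, N = 0 and u ≥ 2^n are harmless edge cases: ℕ-conventions gcd(0−1,N) =
gcd(0,N) = N, empty range, zero count.) Verified exhaustively for n ≤ 5 (all odd N ≤ 2^n, all a;
compute/verify_rank.py). TIGHT up to constants: a = 3, prime N: max_u ≈ 2^{n/2}/4. -/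
@[route_item "route-QuantumAdvantage-PauliFlat", crux]
def XorCoincidenceBound : Prop :=
  ∀ n N a u : ℕ, N ≤ 2 ^ n → 0 < u → u < 2 ^ n → ((Finset.range N).filter fun y => (a * y % N) ^^^ y = u).card ≤ min (Nat.gcd (a - 1) N * 2 ^ ((Finset.range n).filter fun i => u.testBit i).card) (Nat.gcd (a + 1) N * 2 ^ (n - ((Finset.range n).filter fun i => u.testBit i).card))

/-- item stmt-QuantumAdvantage-1992 · support · rank 9 · open · by planner
sources: arXiv:2505.21606 §II (Pauli-propagation estimators: overlap of a t-term Pauli sum with a product state), arXiv:2409.01706, Adleman 1978 (advice pattern BPP ⊆ P/poly), tree QuantumCircuit.acceptProb / ClassBQP.BQPWith (acceptProbOn 0, thresholds 2/3, 1/3)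
[support; calibration of the negative thesis — what the kills kill] H_PP^nu (the NON-UNIFORM
Pauli-truncation hypothesis, the antecedent of this implication and the statement negated by
NegPauliTruncation): for every uniform oracle-free Clifford+T family F there are c and, for each n,
a set T of ≤ n^c + c Pauli strings on the n + ancillas(n) wires with coefficients m : T → ℂ such
that the Heisenberg acceptance observable A_n = U_n†Π₀U_n (U_n = (F.circ n).mat, Π₀ = diagonal
projector 'wire 0 reads true') is 1/10-close to M = Σ_{S∈T} m_S·S in numerical radius (|⟨ψ,(A_n −
M)ψ⟩| ≤ 1/10 for all unit ψ). CLAIM: H_PP^nu → BQP ⊆ P/poly. INTENDED PROOF (the simulation, in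
print as the Pauli-propagation estimator): acceptProbOn 0 F x = ⟨x0^m|A_n|x0^m⟩; advice = T with Re
m_S rounded to 1/(40|T|) (|m_S| ≤ ‖M‖_op ≤ 2·(1 + 1/10), poly bits); ⟨x0^m|S|x0^m⟩ = 0 unless S ∈
{I,Z}^*, else (−1)^{#{i : S_i = Z, x_i = 1}}; a poly-size circuit adds |T| signed dyadic rationals
and compares with 1/2 (2/3 − 1/10 − 1/40 > 1/2 > 1/3 + 1/10 + 1/40). NB: once NegPauliTruncation
lands the implication is also vacuously true — the item's value is to pin down H_PP, exactly as
Dequantize's item 0470. The UNIFORM ve -/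
@[route_item "route-QuantumAdvantage-PauliFlat", crux]
def PPTruncationCollapse : Prop :=
  (∀ F : Literature.Computability.Cryptography.QCircuitFamily Literature.Computability.Cryptography.cliffordT, F.IsOracleFree → F.IsUniform → ∃ c : ℕ, ∀ n : ℕ, ∃ T : Finset (Fin (n + F.ancillas n) → Literature.Computability.QuantumComplexity.Pauli), ∃ m : (Fin (n + F.ancillas n) → Literature.Computability.QuantumComplexity.Pauli) → ℂ, T.card ≤ n ^ c + c ∧ ∀ ψ : Literature.Computability.Cryptography.QReg (n + F.ancillas n) → ℂ, ∑ x, ‖ψ x‖ ^ 2 = 1 → ‖star ψ ⬝ᵥ (((F.circ n).mat)ᴴ * (Matrix.of fun x y : Literature.Computability.Cryptography.QReg (n + F.ancillas n) => if x = y ∧ (∃ h : 0 < n + F.ancillas n, y ⟨0, h⟩ = true) then (1 : ℂ) else 0) * (F.circ n).mat - ∑ S ∈ T, m S • Literature.Computability.QuantumComplexity.pauliString S).mulVec ψ‖ ≤ 1 / 10) → Literature.Computability.Cryptography.BQP ⊆ Literature.Computability.Complexity.PPoly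

/-- item stmt-QuantumAdvantage-1993 · support · rank 9 · open · by planner
sources: Kitaev quant-ph/9511026 (one-control-qubit phase estimation), arXiv:2505.21606 Box 4 p.14, tree KitaevPhaseEstimationCircuit / ReversibleCliffordT / RevUncompute (exact compilation of reversible permutations), planner NOTES.md (KitaevCutKill bookkeeping)
[support; PROVABLE NOW given ModMulPauliRank — the complexity-level form of the kill] ¬H_PP^nu:
there is a uniform oracle-free Clifford+T family F such that for every c some A_n = U_n†Π₀U_n admits
NO (n^c + c)-term Pauli sum within 1/10 in numerical radius. WITNESS (KitaevCutKill bookkeeping):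
F_n = Kitaev's one-control-qubit sandwich H_c · C-W · H_c, control = wire 0, W = an exactly compiled
reversible permutation with flat off-Z Pauli spectrum and clean ancillas — e.g. modular
multiplication W_{a_n,N_n} with explicit g₋ = g₊ = 1 (ModMulPauliRank), or simply W_{2,2^n−1} = the
cyclic wire rotation (a controlled-SWAP/Fredkin ladder, exact Clifford+T, no ancillas;
XOR-coincidences ≤ 2). CHAIN: numerical radius ≤ 1/10 ⇒ ‖A − M‖_op ≤ 1/5 ⇒ compress to the
ancilla-|0^m⟩ block (clean ancillas: ⟨φ0^m|A|φ′0^m⟩ = ⟨φ|V†Π₀V|φ′⟩ with V the ideal unitary;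
⟨0^m|M|0^m⟩ = Σ_{S∈T, S_anc ∈ {I,Z}^m} ±m_S S_sys is again ≤|T|-sparse) ⇒ ‖O − M₀₀‖_F² ≤ 2^{n+1}/25
for O = V†Π₀V = ½I − ¼Z_c⊗(W+W†) + (i/4)Y_c⊗(W−W†), whose (Z_c,Y_c)-sectors carry Re/Im of every
Pauli coefficient of W isometrically ⇒ by ModMulPauliRank ½((N − g₋) − |T|g₋g₊) ≤ 2^{n+1}/25 ⇒ |T| ≥
0.34·2^n − 1 > n^c + c for large n. REMARK (hon -/
@[route_item "route-QuantumAdvantage-PauliFlat", crux]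
def NegPauliTruncation : Prop :=
  ¬ (∀ F : Literature.Computability.Cryptography.QCircuitFamily Literature.Computability.Cryptography.cliffordT, F.IsOracleFree → F.IsUniform → ∃ c : ℕ, ∀ n : ℕ, ∃ T : Finset (Fin (n + F.ancillas n) → Literature.Computability.QuantumComplexity.Pauli), ∃ m : (Fin (n + F.ancillas n) → Literature.Computability.QuantumComplexity.Pauli) → ℂ, T.card ≤ n ^ c + c ∧ ∀ ψ : Literature.Computability.Cryptography.QReg (n + F.ancillas n) → ℂ, ∑ x, ‖ψ x‖ ^ 2 = 1 → ‖star ψ ⬝ᵥ (((F.circ n).mat)ᴴ * (Matrix.of fun x y : Literature.Computability.Cryptography.QReg (n + F.ancillas n) => if x = y ∧ (∃ h : 0 < n + F.ancillas n, y ⟨0, h⟩ = true) then (1 : ℂ) else 0) * (F.circ n).mat - ∑ S ∈ T, m S • Literature.Computability.QuantumComplexity.pauliString S).mulVec ψ‖ ≤ 1 / 10)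

-- earlier Assembly (stmt-QuantumAdvantage-0243, replaced 2026-08-15T16:19:54Z -> stmt-QuantumAdvantage-10636): retired by None — Literature.Computability.QuantumComplexity.BPP_subset_BQP → Literature.Computability.Cryptography.BQP ⊆ Literature.Computability.Complexity.BPP → ¬ QuantumAdvantage
/-- item stmt-QuantumAdvantage-10636 · assembly · rank 1 · open · by planner
sources: BernsteinVazirani1997 §8
[assembly] Documentary frame of the deciding theorem: X → ¬QuantumAdvantage. The summit is the
existential form ∃ L, L ∈ BQP ∧ L ∉ BPP (Statement.lean, D-0015), so X = PPThesis (BQP ⊆ BPP)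
refutes it by pure logic; provable now in one line (fun h0 ⟨_, hL, hnL⟩ => hnL (h0 hL)). Restated at
route-repair 2026-08-15: the former first hypothesis
Literature.Computability.QuantumComplexity.BPP_subset_BQP (BernsteinVazirani1997 §8) is unused
against the existential form and, being an unlisted Literature fact, was glue.extra-hypothesis —
removed (mirrors Dequantize rev 4). The deciding theorem itself is `closes` (all nine listed items →
¬ QuantumAdvantage). -/
@[route_item "route-QuantumAdvantage-PauliFlat", crux]
def Assembly : Prop :=
  PPThesis → ¬ QuantumAdvantage

/-! D-0027 §2.1 — DECIDING THEOREM (planner-authored via `route open/edit --closes-file`; by planner-rbadge-QuantumAdvantage-PauliFlat-4271e1e9-g2-0 2026-08-15T16:19:54Z):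
its hypotheses are this route's items and its conclusion the sub-problem Statement (glue_lint), and it elaborates with this file. -/

@[closes "route-QuantumAdvantage-PauliFlat"] theorem closes (h0 : PPThesis) (_h2 : ModMulPauliRank) (_h3 : DigitWalshFlat) (_h4 : ProductFrameFlat) (_h5 : KappaTypical) (_s1 : XorCoincidenceBound) (_s2 : PPTruncationCollapse) (_s3 : NegPauliTruncation) (_hA : Assembly) : ¬ _root_.QuantumAdvantage :=
  fun ⟨_, hL, hnL⟩ => hnL (h0 hL)

end Summit.QuantumAdvantage.QuantumAdvantage.Theses.PauliFlat
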